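import Mathlib
import Summits.ResolutionOfSingularities.ResolutionOfSingularities.Theorems.HomologicalConductorPersistenceCycleDivisorDegree
import Summits.ResolutionOfSingularities.ResolutionOfSingularities.Theorems.HomologicalConductorNoZenoCycleDivisorOrder
import Literature.AlgebraicGeometry.Motives.CartierDivisorBlowupExcess
import HarnessLib

/-!
# [OURS · L1 w44b] K-PCC sheaf half, FILE 1b: the EXCEPTIONAL PART of an effective Cartier divisor on a
# regular scheme, and the degree inequality (★) `P_s · C_i ≤ (𝒪_X(D) · C_i)` for global sections

Rung S-2 `HomologicalConductor.PersistenceSurface` (stmt-ResolutionOfSingularities-19970), route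
`ResolutionOfSingularities/HomologicalConductor`, chain W4.4b (cell res-hironaka), WAVE-3 row «stub-3 → K-PCC
SHEAF HALF» (lead memo K-PCC, res-L1-w44b-lead-1 g4; lattice half `…PersistencePointedCycles`). `[OURS · L1 w44b]`
folklore in the W4.4 `NoZeno` resolution vocabulary; replaces the role of no printed item; NOT a statement of the
manuscript under review and nothing of it is used; AI-written, weaker than expert review. DECL MAP:
`L/res-L1-w44b-stub-3/g8/KPCC-SHEAF-DECLMAP.md`; FILE 1a = `…PersistenceCycleDivisorDegree`.

K-PCC Thm 2.3 (pointed ceiling `tr(M_{−δ_t}) ⊆ I(Z⁽ᵗ⁾ − A⁽ᵗ⁾)`) rests on the inequality (★): for a section `s`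
of `𝒪_X(D)` the EXCEPTIONAL PART `P_s` of the effective divisor `D + div(s)` satisfies `P_s · C_i ≤ (𝒪_X(D)·C_i)`
for every exceptional curve `C_i` — because `D + div(s) = P_s + N` with `N ≥ 0` not containing any `C_i`, so
`(N·C_i) ≥ 0` (Lipman §12 Remark 2 c)) and `(div(s)·C_i) = 0`. This file types it for GLOBAL sections
(`CartierDivisor.IsSection`); the punctured version (sections off the closed fibre) is FILE 2.

* `le_cycleIdeal_of_forall_stalkIdeal_le` — on a regular `X`, an ideal sheaf whose stalk at each codimension-one
  point `η ∈ F` lies in `𝔪_η^{P η}` lies in the cycle ideal `∏_{η ∈ F} 𝓘_{E_η}^{P η}` (factoriality; W4.4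
  `mem_stalkIdeal_cycleIdeal_of_forall`, tree `le_primeDivisorIdeal_pow_of_isRegular`);
* `isEffective_sub_ofIsEffectiveCartier_of_le`, `sub_ofIsEffectiveCartier_avoids_of_stalkIdeal_eq` — for
  invertible ideal sheaves `I ≤ J` the difference `D_I − D_J` is effective, and avoids every point where
  `I_y = J_y`;
* `stalkIdeal_idealSheaf_eq_span`, `sameDivisor_ofIsEffectiveCartier_idealSheaf` — an
  effective Cartier divisor `G` IS the divisor of its ideal sheaf `𝒪_X(−G)` (tree `IsEffective.idealSheaf`), whose
  stalks are generated by the germs of the local equations; `span_singleton_eq_maximalIdeal_pow_of_ord_eq` —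
  at a codimension-one point a germ of order `n` generates `𝔪^n`;
* **`isEffective_exceptionalPart` / `exceptionalPart_avoids`** — for `G` effective and `P ≤ ord_F(G)` the
  divisor `G − D_P` is effective, and avoids `η₀ ∈ F` when `P η₀ = ord_{η₀} G`;
* **`excCurveDegree_cycleDivisor_le_of_isSection`** — (★): `s ∈ Γ(X, 𝒪_X(D))`, `s ≠ 0`, `G = D + div(s)`,
  `P ≤ ord_F G` with equality at the exceptional curve `η₀ ∈ F` ⇒ `(𝒪_X(D_P)·E_{η₀}) ≤ (𝒪_X(D)·E_{η₀})`;
  **`sum_mul_excCurveDegree_le_of_isSection`** — the lattice form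
  `Σ_{η ∈ F} P η · ([E_η]·E_{η₀}) ≤ (𝒪_X(D)·E_{η₀})` (FILE 1a `excCurveDegree_cycleDivisor`), i.e. the input
  `P_s·C_i ≤ d_i` of K-PCC Thm 2.3 with the lead's pairing `Σ_j P_j M j i`, `M j i := excCurveDegree π [E_j] η_i`.

References: U. Görtz, T. Wedhorn, *Algebraic Geometry I* (2nd ed. 2020), (11.9), (11.12), Remark 11.27,
Thm. 11.40 [`GortzWedhorn2020`]; J. Lipman, Publ. Math. IHÉS 36 (1969), §12 Remark 2 b)–c) (p. 221)
[`Lipman1969`]; V. Cossart, O. Piltant, J. Algebra 320 (2008), proof of Prop. 4.2 (divisorial part)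
[`CossartPiltant2008`].
-/

set_option linter.dupNamespace false
set_option autoImplicit false

noncomputable section

open CategoryTheory AlgebraicGeometry TopologicalSpace IsLocalRing Opposite Order
open Literature.AlgebraicGeometry.Motives Literature.AlgebraicGeometry.Motives.RatFn
open Literature.AlgebraicGeometry.Resolution
open Summit.ResolutionOfSingularities.ResolutionOfSingularities.Theorems.NoZeno.SandwichCluster

universe u

namespace Summit.ResolutionOfSingularities.ResolutionOfSingularities.Theorems.HomologicalConductor.PersistencePointedCeiling

variable {X : Scheme.{u}} [IsIntegral X] [IsLocallyNoetherian X]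

/-! ## Ideal sheaves below a cycle ideal -/

omit [IsLocallyNoetherian X] in
/-- **An ideal sheaf with `I_η ⊆ 𝔪_η^{P η}` at the codimension-one points `η ∈ F` lies in the cycle ideal
`∏_{η ∈ F} 𝓘_{E_η}^{P η}`** (regular `X`: the local rings are factorial). [cite: CossartPiltant2008, proof of Prop. 4.2] -/
theorem le_cycleIdeal_of_forall_stalkIdeal_le (hX : Scheme.IsRegular X) (F : Finset X) (P : X → ℕ)
    (hF : ∀ η ∈ F, coheight η = 1) {I : X.IdealSheafData}
    (hP : ∀ η ∈ F, stalkIdeal I η ≤ maximalIdeal (X.presheaf.stalk η) ^ P η) :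
    I ≤ ∏ η ∈ F, primeDivisorIdeal η ^ P η := by
  refine le_of_forall_stalkIdeal_le fun y f hf => ?_
  refine mem_stalkIdeal_cycleIdeal_of_forall hX F P hF y fun η hη _ => ?_
  exact stalkIdeal_mono (le_primeDivisorIdeal_pow_of_isRegular hX (hF η hη) (hP η hη)) y hf

/-! ## `D_I − D_J` for invertible ideal sheaves `I ≤ J` -/

omit [IsLocallyNoetherian X] in
/-- **`D_I − D_J` is effective when `I ≤ J`** (both invertible): the generator of `I_y` is a multiple of the
generator of `J_y`. [cite: GortzWedhorn2020, Remark 11.27 and (11.12) (pp. 378–379)] -/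
theorem isEffective_sub_ofIsEffectiveCartier_of_le {I J : X.IdealSheafData} (hI : IsEffectiveCartier I)
    (hJ : IsEffectiveCartier J) (hle : I ≤ J) :
    ((CartierDivisor.ofIsEffectiveCartier I hI).sub (CartierDivisor.ofIsEffectiveCartier J hJ)).IsEffective := by
  refine CartierDivisor.isEffective_sub_of_forall_exists fun y =>
    ⟨y, y, CartierDivisor.mem_cartierChart I hI y, CartierDivisor.mem_cartierChart J hJ y, ?_⟩
  have hyI := CartierDivisor.mem_cartierChart I hI y
  have hyJ := CartierDivisor.mem_cartierChart J hJ y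
  have hmem : (X.presheaf.germ _ y hyI).hom (CartierDivisor.cartierGen I hI y) ∈ stalkIdeal J y := by
    refine stalkIdeal_mono hle y ?_
    rw [stalkIdeal_eq_span_germ_cartierGen_of_mem I hI hyI]
    exact Ideal.subset_span rfl
  rw [stalkIdeal_eq_span_germ_cartierGen_of_mem J hJ hyJ, Ideal.mem_span_singleton'] at hmem
  obtain ⟨a, ha⟩ := hmem
  change IsRegularAt y (secFn hyI (CartierDivisor.cartierGen I hI y) / secFn hyJ (CartierDivisor.cartierGen J hJ y))
  refine ⟨a, ?_⟩
  have hJ0 : secFn hyJ (CartierDivisor.cartierGen J hJ y) ≠ 0 :=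
    (CartierDivisor.ofIsEffectiveCartier J hJ).f_ne_zero y
  rw [eq_div_iff hJ0, ← toFunctionField_germ_eq_secFn hyI hyI, ← toFunctionField_germ_eq_secFn hyJ hyJ,
    ← map_mul, ha]

omit [IsLocallyNoetherian X] in
/-- **`D_I − D_J` avoids a point where `I_y = J_y`**: there the two generators are associated.
[cite: GortzWedhorn2020, Section (11.9) (p. 374)] -/
theorem sub_ofIsEffectiveCartier_avoids_of_stalkIdeal_eq {I J : X.IdealSheafData} (hI : IsEffectiveCartier I)
    (hJ : IsEffectiveCartier J) {y : X} (he : stalkIdeal I y = stalkIdeal J y) :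
    ((CartierDivisor.ofIsEffectiveCartier I hI).sub (CartierDivisor.ofIsEffectiveCartier J hJ)).Avoids y := by
  have hyI := CartierDivisor.mem_cartierChart I hI y
  have hyJ := CartierDivisor.mem_cartierChart J hJ y
  refine CartierDivisor.sub_avoids_of_isUnitAt hyI hyJ ?_
  have h : Ideal.span {(X.presheaf.germ _ y hyI).hom (CartierDivisor.cartierGen I hI y)} =
      Ideal.span {(X.presheaf.germ _ y hyJ).hom (CartierDivisor.cartierGen J hJ y)} := by
    rw [← stalkIdeal_eq_span_germ_cartierGen_of_mem I hI hyI,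
      ← stalkIdeal_eq_span_germ_cartierGen_of_mem J hJ hyJ, he]
  have hu := isUnitAt_div_of_span_singleton_eq h (germ_cartierGen_ne_zero J hJ hyJ)
  rwa [toFunctionField_germ_eq_secFn hyI hyI, toFunctionField_germ_eq_secFn hyJ hyJ] at hu

/-! ## An effective Cartier divisor is the divisor of its ideal sheaf -/

omit [IsLocallyNoetherian X] in
/-- **The stalk of `𝒪_X(−G)` at `y` is generated by the germ of the local equation**: for `G` effective,
`y ∈ U_i` and any germ `γ` at `y` representing `f_i`, `𝒪_X(−G)_y = (γ)`.
[cite: GortzWedhorn2020, Remark 11.27 and (11.12) (pp. 378–379)] -/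
theorem stalkIdeal_idealSheaf_eq_span {G : CartierDivisor X} (hG : G.IsEffective) {i : G.ι}
    {y : X} (hyi : y ∈ G.U i) {γ : X.presheaf.stalk y} (hγ : toFunctionField y γ = G.f i) :
    stalkIdeal hG.idealSheaf y = Ideal.span {γ} := by
  obtain ⟨W, hyW, hWi, -, t, ht⟩ := hG.exists_affine_secFn_eq hyi (O := ⊤) trivial
  have hγt : (X.presheaf.germ _ y hyW).hom t = γ :=
    toFunctionField_injective y (by rw [toFunctionField_germ_eq_secFn hyW hyW, ht, hγ])
  rw [stalkIdeal_eq_map_germ _ W hyW, CartierDivisor.IsEffective.ideal_idealSheaf,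
    CartierDivisor.sectionIdeal_eq_span hyW hWi ht, Ideal.map_span, Set.image_singleton, hγt]

omit [IsLocallyNoetherian X] in
/-- **An effective Cartier divisor IS the divisor of its ideal sheaf**: `G` and `D_{𝒪_X(−G)}`
(`ofIsEffectiveCartier` of `IsEffective.idealSheaf`) are the same Cartier divisor.
[cite: GortzWedhorn2020, Remark 11.27 and (11.12) (pp. 378–379)] -/
theorem sameDivisor_ofIsEffectiveCartier_idealSheaf {G : CartierDivisor X} (hG : G.IsEffective) :
    G.SameDivisor (CartierDivisor.ofIsEffectiveCartier hG.idealSheaf hG.isEffectiveCartier_idealSheaf) := by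
  intro i x y hyi hy
  have hy' : y ∈ (CartierDivisor.cartierChart hG.idealSheaf hG.isEffectiveCartier_idealSheaf x : X.Opens) := hy
  obtain ⟨γ, hγ⟩ := hG i y hyi
  -- `γ` is a germ with `γ = f_i`; both `γ` and the chart generator generate `𝒪_X(−G)_y`
  have h : Ideal.span {γ} = Ideal.span {(X.presheaf.germ _ y hy').hom
      (CartierDivisor.cartierGen hG.idealSheaf hG.isEffectiveCartier_idealSheaf x)} := by
    rw [← stalkIdeal_idealSheaf_eq_span hG hyi hγ,
      stalkIdeal_eq_span_germ_cartierGen_of_mem _ _ hy']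
  have hu := isUnitAt_div_of_span_singleton_eq h (germ_cartierGen_ne_zero _ _ hy')
  rw [hγ, toFunctionField_germ_eq_secFn (CartierDivisor.mem_cartierChart _ _ x) hy'] at hu
  exact hu

/-! ## Orders at codimension-one points of a regular scheme -/

/-- **A germ of order `n` at a codimension-one point of a regular scheme generates `𝔪^n`.** [folklore] -/
theorem span_singleton_eq_maximalIdeal_pow_of_ord_eq (hX : Scheme.IsRegular X) {η : X}
    (hη : coheight η = 1) {τ : X.presheaf.stalk η} (hτ : τ ≠ 0) {n : ℕ}
    (hord : Scheme.ord (toFunctionField η τ) η = n) :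
    Ideal.span {τ} = maximalIdeal (X.presheaf.stalk η) ^ n := by
  haveI := isDiscreteValuationRing_stalk_of_coheight_eq_one hX hη
  obtain ⟨ϖ, hϖ⟩ := IsDiscreteValuationRing.exists_irreducible (X.presheaf.stalk η)
  obtain ⟨k, hk⟩ := IsDiscreteValuationRing.associated_pow_irreducible hτ hϖ
  have hspan : Ideal.span {τ} = maximalIdeal (X.presheaf.stalk η) ^ k := by
    rw [hϖ.maximalIdeal_eq, Ideal.span_singleton_pow]
    exact Ideal.span_singleton_eq_span_singleton.mpr hk
  have hk' := ord_toFunctionField_eq_of_span_eq hX hη hτ hspan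
  rw [hord] at hk'
  have : n = k := by exact_mod_cast hk'
  subst this
  exact hspan

/-- For an effective divisor `G`, a codimension-one point `η ∈ U_i` of a regular scheme and `P ≤ ord_η G`:
`𝒪_X(−G)_η ⊆ 𝔪_η^P`. [folklore] -/
theorem stalkIdeal_idealSheaf_le_maximalIdeal_pow (hX : Scheme.IsRegular X)
    {G : CartierDivisor X} (hG : G.IsEffective) {η : X} (hη : coheight η = 1) {P : ℕ}
    (hP : (P : ℤ) ≤ G.ordAt η) :
    stalkIdeal hG.idealSheaf η ≤ maximalIdeal (X.presheaf.stalk η) ^ P := by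
  obtain ⟨i, hi⟩ := G.covers η
  obtain ⟨γ, hγ⟩ := hG i η hi
  have hγ0 : γ ≠ 0 := fun h0 => G.f_ne_zero i (by rw [← hγ, h0, map_zero])
  rw [stalkIdeal_idealSheaf_eq_span hG hi hγ, Ideal.span_singleton_le_iff_mem,
    ← le_ord_toFunctionField_iff_mem_maximalIdeal_pow hX hη hγ0, hγ, ← G.ordAt_eq_ord hi]
  exact hP

/-- For an effective divisor `G` and a codimension-one point `η` of a regular scheme:
`𝒪_X(−G)_η = 𝔪_η^{ord_η G}`. [folklore] -/
theorem stalkIdeal_idealSheaf_eq_maximalIdeal_pow (hX : Scheme.IsRegular X)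
    {G : CartierDivisor X} (hG : G.IsEffective) {η : X} (hη : coheight η = 1) {P : ℕ}
    (hP : (P : ℤ) = G.ordAt η) :
    stalkIdeal hG.idealSheaf η = maximalIdeal (X.presheaf.stalk η) ^ P := by
  obtain ⟨i, hi⟩ := G.covers η
  obtain ⟨γ, hγ⟩ := hG i η hi
  have hγ0 : γ ≠ 0 := fun h0 => G.f_ne_zero i (by rw [← hγ, h0, map_zero])
  rw [stalkIdeal_idealSheaf_eq_span hG hi hγ]
  refine span_singleton_eq_maximalIdeal_pow_of_ord_eq hX hη hγ0 ?_
  rw [hγ, ← G.ordAt_eq_ord hi, ← hP]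

/-! ## The exceptional part of an effective Cartier divisor -/

/-- **`G − D_P` is effective** for an effective Cartier divisor `G` on a regular scheme, a finite set `F` of
codimension-one points and multiplicities `P ≤ ord_F(G)` (`D_P` = the divisor of the cycle ideal
`∏_{η∈F} 𝓘_{E_η}^{P η}`; `G` is replaced by the divisor of its ideal sheaf, the same divisor).
[cite: GortzWedhorn2020, Thm. 11.40 (2) and Remark 11.27] -/
theorem isEffective_exceptionalPart (hX : Scheme.IsRegular X) (F : Finset X) (P : X → ℕ)
    (hF : ∀ η ∈ F, coheight η = 1) {G : CartierDivisor X} (hG : G.IsEffective)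
    (hP : ∀ η ∈ F, (P η : ℤ) ≤ G.ordAt η) :
    ((CartierDivisor.ofIsEffectiveCartier hG.idealSheaf hG.isEffectiveCartier_idealSheaf).sub
      (CartierDivisor.ofIsEffectiveCartier (∏ η ∈ F, primeDivisorIdeal η ^ P η)
        (isEffectiveCartier_cycleIdeal hX F P hF))).IsEffective :=
  isEffective_sub_ofIsEffectiveCartier_of_le _ _
    (le_cycleIdeal_of_forall_stalkIdeal_le hX F P hF fun η hη =>
      stalkIdeal_idealSheaf_le_maximalIdeal_pow hX hG (hF η hη) (hP η hη))

/-- **`G − D_P` avoids `η₀ ∈ F` when `P η₀ = ord_{η₀} G`** (there both ideal sheaves have stalk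
`𝔪_{η₀}^{P η₀}`). [cite: GortzWedhorn2020, Section (11.9) (p. 374)] -/
theorem exceptionalPart_avoids (hX : Scheme.IsRegular X) (F : Finset X) (P : X → ℕ)
    (hF : ∀ η ∈ F, coheight η = 1) {G : CartierDivisor X} (hG : G.IsEffective)
    {η₀ : X} (hη₀ : η₀ ∈ F) (hP₀ : (P η₀ : ℤ) = G.ordAt η₀) :
    ((CartierDivisor.ofIsEffectiveCartier hG.idealSheaf hG.isEffectiveCartier_idealSheaf).sub
      (CartierDivisor.ofIsEffectiveCartier (∏ η ∈ F, primeDivisorIdeal η ^ P η)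
        (isEffectiveCartier_cycleIdeal hX F P hF))).Avoids η₀ := by
  have hanti : ∀ η ∈ F, η ⤳ η₀ → η = η₀ := fun η hη h => by
    by_contra hne
    exact not_specializes_of_coheight_eq_one (hF η hη) (hF η₀ hη₀) hne h
  refine sub_ofIsEffectiveCartier_avoids_of_stalkIdeal_eq _ _ ?_
  rw [stalkIdeal_idealSheaf_eq_maximalIdeal_pow hX hG (hF η₀ hη₀) hP₀,
    stalkIdeal_cycleIdeal_self F P hη₀ hanti]

/-! ## (★) The degree inequality for global sections -/

section Star

variable {T : Type u} [CommRing T] [IsLocalRing T] (π : X ⟶ Spec (.of T)) [IsProper π]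

/-- **(★), divisor form.** Let `X → Spec T` be proper over a local ring with `X` integral, regular and
locally noetherian, `F` a finite set of codimension-one points, `s ≠ 0` a GLOBAL section of `𝒪_X(D)`,
`G = D + div(s)` (effective) and `P ≤ ord_F(G)` with equality at `η₀ ∈ F`, an integral exceptional curve.
Then `(𝒪_X(D_P) · E_{η₀}) ≤ (𝒪_X(D) · E_{η₀})`: indeed `G − D_P` is effective and avoids `η₀`, so it meets
`E_{η₀}` non-negatively, and `(div(s)·E_{η₀}) = 0`. [cite: Lipman1969, Section 12, Remark 2 b)–c) (p. 221)] -/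
theorem excCurveDegree_cycleDivisor_le_of_isSection (hX : Scheme.IsRegular X) (F : Finset X) (P : X → ℕ)
    (hF : ∀ η ∈ F, coheight η = 1) (D : CartierDivisor X) {s : X.functionField} (hs0 : s ≠ 0)
    (hs : D.IsSection s) (hP : ∀ η ∈ F, (P η : ℤ) ≤ (D + CartierDivisor.principal s hs0).ordAt η)
    {η₀ : X} (hη₀F : η₀ ∈ F) (hη₀ : η₀ ∈ excCurvePoints π)
    (hP₀ : (P η₀ : ℤ) = (D + CartierDivisor.principal s hs0).ordAt η₀) :
    excCurveDegree π (CartierDivisor.ofIsEffectiveCartier (∏ η ∈ F, primeDivisorIdeal η ^ P η)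
      (isEffectiveCartier_cycleIdeal hX F P hF)) η₀ ≤ excCurveDegree π D η₀ := by
  set G := D + CartierDivisor.principal s hs0 with hGdef
  have hG : G.IsEffective := (CartierDivisor.isEffective_add_principal_iff (D := D) hs0).mpr hs
  set DG := CartierDivisor.ofIsEffectiveCartier hG.idealSheaf hG.isEffectiveCartier_idealSheaf
  set DP := CartierDivisor.ofIsEffectiveCartier (∏ η ∈ F, primeDivisorIdeal η ^ P η)
    (isEffectiveCartier_cycleIdeal hX F P hF)
  -- `0 ≤ ((DG − DP) · E_{η₀})`
  have h0 : 0 ≤ excCurveDegree π (DG.sub DP) η₀ :=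
    excCurveDegree_nonneg_of_isEffective π hη₀ (isEffective_exceptionalPart hX F P hF hG hP)
      (exceptionalPart_avoids hX F P hF hG hη₀F hP₀)
  -- `((DG − DP)·E) + (DP·E) = (DG·E) = (G·E) = (D·E) + 0`
  have h1 : excCurveDegree π (DG.sub DP) η₀ + excCurveDegree π DP η₀ = excCurveDegree π D η₀ := by
    rw [← excCurveDegree_add π hη₀, excCurveDegree_congr_linEquiv π hη₀ (DG.sub_add_sameDivisor DP).linEquiv,
      ← excCurveDegree_congr_linEquiv π hη₀ (sameDivisor_ofIsEffectiveCartier_idealSheaf hG).linEquiv, hGdef,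
      excCurveDegree_add π hη₀, excCurveDegree_principal π hη₀ hs0, add_zero]
  omega

/-- **(★), lattice form.** Under the same hypotheses, with `M η η₀ := ([E_η]·E_{η₀})` the intersection numbers of
the prime divisors of `F`: `Σ_{η ∈ F} P η · M η η₀ ≤ (𝒪_X(D)·E_{η₀})` — the input `P_s·C_i ≤ d_i` of K-PCC
Thm 2.3 (lattice pairing of `…PersistencePointedCycles`). [cite: Lipman1969, Section 12, Remark 2 b)–c) (p. 221)] -/
theorem sum_mul_excCurveDegree_le_of_isSection (hX : Scheme.IsRegular X) (F : Finset X) (P : X → ℕ)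
    (hF : ∀ η ∈ F, coheight η = 1) (D : CartierDivisor X) {s : X.functionField} (hs0 : s ≠ 0)
    (hs : D.IsSection s) (hP : ∀ η ∈ F, (P η : ℤ) ≤ (D + CartierDivisor.principal s hs0).ordAt η)
    {η₀ : X} (hη₀F : η₀ ∈ F) (hη₀ : η₀ ∈ excCurvePoints π)
    (hP₀ : (P η₀ : ℤ) = (D + CartierDivisor.principal s hs0).ordAt η₀) :
    ∑ η ∈ F.attach, (P η : ℤ) * excCurveDegree π (CartierDivisor.ofIsEffectiveCartier
        (primeDivisorIdeal (η : X)) (isEffectiveCartier_primeDivisorIdeal_of_isRegular hX (hF η η.2))) η₀ ≤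
      excCurveDegree π D η₀ := by
  rw [← excCurveDegree_cycleDivisor π hX F P hF hη₀ (isEffectiveCartier_cycleIdeal hX F P hF)]
  exact excCurveDegree_cycleDivisor_le_of_isSection π hX F P hF D hs0 hs hP hη₀F hη₀ hP₀

/-- **(★) with the full exceptional part.** For `G = D + div(s)` effective take `P η := (ord_η G).toNat` on
`F`: then `Σ_{η ∈ F} ord_η(G) · ([E_η]·E_{η₀}) ≤ (𝒪_X(D)·E_{η₀})` for every integral exceptional curve
`η₀ ∈ F`. [cite: Lipman1969, Section 12, Remark 2 b)–c) (p. 221)] -/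
theorem sum_ordAt_mul_excCurveDegree_le_of_isSection (hX : Scheme.IsRegular X) (F : Finset X)
    (hF : ∀ η ∈ F, coheight η = 1) (D : CartierDivisor X) {s : X.functionField} (hs0 : s ≠ 0)
    (hs : D.IsSection s) {η₀ : X} (hη₀F : η₀ ∈ F) (hη₀ : η₀ ∈ excCurvePoints π) :
    ∑ η ∈ F.attach, (D + CartierDivisor.principal s hs0).ordAt η *
        excCurveDegree π (CartierDivisor.ofIsEffectiveCartier (primeDivisorIdeal (η : X))
          (isEffectiveCartier_primeDivisorIdeal_of_isRegular hX (hF η η.2))) η₀ ≤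
      excCurveDegree π D η₀ := by
  have hG : (D + CartierDivisor.principal s hs0).IsEffective :=
    (CartierDivisor.isEffective_add_principal_iff (D := D) hs0).mpr hs
  have hnn : ∀ η, 0 ≤ (D + CartierDivisor.principal s hs0).ordAt η := fun η => hG.ordAt_nonneg η
  have h := sum_mul_excCurveDegree_le_of_isSection π hX F
    (fun η => ((D + CartierDivisor.principal s hs0).ordAt η).toNat) hF D hs0 hs
    (fun η _ => by rw [Int.toNat_of_nonneg (hnn η)]) hη₀F hη₀ (by rw [Int.toNat_of_nonneg (hnn η₀)])
  simpa only [Int.toNat_of_nonneg (hnn _)] using h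

end Star

end Summit.ResolutionOfSingularities.ResolutionOfSingularities.Theorems.HomologicalConductor.PersistencePointedCeiling

end
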